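import Summits.RiemannHypothesis.RiemannHypothesis.Theorems.PfPersistenceWeilParityPair
import Summits.RiemannHypothesis.RiemannHypothesis.Theorems.PfPersistenceInWindowMirror
import HarnessLib

/-!
# PF persistence — the WEIL PARITY PAIR of a weight table; the EDGE × MEAN zero law and the order bit at every
# window (pub-rhpf, cand-6 gen 5; leaf G1.05eo-ORDER; helper for item stmt-RiemannHypothesis-19953)

**HONEST FRAMING. This is a long-odds MECHANISM SEARCH; no RH claims.** RH-free, sorry-free linear algebra about
the cell's observatory records (finite sections of the truncated Weil form of an ARBITRARY weight table); nothing
here bears on the truth of RH.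

`PfPersistenceParityTransfer` (cand-3) typed an abstract `ParityPair` — even corner/border/body, odd block,
frequencies, `φ`, constants `κ, β` tied by a DISPLACEMENT and a BORDER relation — and proved the transfer
identities, the dichotomy at a parity crossing and the zero set of EDGE × MEAN for it, leaving the instantiation
by the actual blocks OWED. This file pays it:

* §1 `weilParityPair w win : ParityPair win.N` — the pair of the weight table `w` at the window `win`
  (`P, b, q00` from `evenBlock`, `M = oddBlock`, `ω_j = 2π(j+1)/L`, `φ_j = W(sin(ω_j ·))`, `κ = 2/L`, `β = √2/L`,
  `L = 2a`); the two relations are `oddBlock_displacement`, `evenBlock_border` (from the pointwise identities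
  `thetaOdd_displacement`, `thetaEven_border` and the linearity of `W`, `weil_lincomb`).
* §2 its even / odd eigenpairs are exactly the eigenpairs of `evenBlock` / `oddBlock` (`isEvenEigen_iff`,
  `isOddEigen_iff`); its edge sum is `(2/L)^{1/2} θ_v(a)` (`edgeSum_eq_profile`, via `profile_edge`).
* §3 THE EDGE × MEAN ZERO LAW for every weight table and window (`profile_mul_mean_eq_zero_iff`): at a simple
  even eigenvalue `ε` with eigenvector `v`, `θ_v(a) · v₀ = 0 ⟺ ε ∈ spec(oddBlock)`; one way without simplicity
  (`exists_oddEigen_of_profile_mul_mean_eq_zero`); hence THE ORDER BIT: an edge or mean zero of an even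
  eigenvector forces `ε₁(odd) ≤ ε` (`bottomRayleigh_oddBlock_le`), and "even STRICTLY bottom" at a window forces
  `θ_v(a) · v₀ ≠ 0` for its bottom vectors (`profile_mul_mean_ne_zero_of_bottom_lt`).
-/

set_option linter.dupNamespace false  -- the mandated namespace repeats `RiemannHypothesis`

noncomputable section

open Real Finset Matrix

namespace Summit.RiemannHypothesis.RiemannHypothesis.Theorems.PfPersistence

open Summit.RiemannHypothesis.RiemannHypothesis.Theorems.PfPersistenceParityTransfer (thetaOdd ParityPair
  thetaOdd_displacement thetaEven_border profile_edge)

/-! ## §1 The Weil parity pair of a weight table at a window -/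

/-- the mode frequencies `ω_j = 2π(j+1)/L`, `L = 2a`, of the modes `1 … N`. [folklore] -/
def modeFreq (win : Window) (j : Fin win.N) : ℝ := 2 * π * ((((j : ℕ) + 1 : ℕ) : ℝ)) / (2 * win.a)

/-- `φ_j = W(sin(ω_j ·))`: Weil's functional of the weight table on the sine of frequency `ω_j`. [folklore] -/
def sineWeil (w : Weights) (win : Window) (j : Fin win.N) : ℝ :=
  weil (2 * win.a) w (fun y => Real.sin (2 * π * ((((j : ℕ) + 1 : ℕ) : ℝ)) * y / (2 * win.a)))

/-- PROVED: the mode frequencies are positive. [folklore] -/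
theorem modeFreq_pos (win : Window) (j : Fin win.N) : 0 < modeFreq win j := by
  unfold modeFreq
  have := win.ha
  positivity

/-- PROVED: the odd block is the lower `N × N` corner of the sector block of the kernel `thetaOdd`. [folklore] -/
theorem oddBlock_eq_sectorBlock (w : Weights) (win : Window) (i j : Fin win.N) :
    oddBlock w win i j = sectorBlock thetaOdd w win i.succ j.succ := rfl

/-- **PROVED (DISPLACEMENT RELATION, integrated).** For every weight table and window:
`ω_i M_{ij} − P_{ij} ω_j = (2/L) φ_j`. [folklore] -/
theorem oddBlock_displacement (w : Weights) (win : Window) (i j : Fin win.N) :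
    modeFreq win i * oddBlock w win i j - evenBlock w win i.succ j.succ * modeFreq win j =
      2 / (2 * win.a) * sineWeil w win j := by
  have hL : 0 ≤ 2 * win.a := by linarith [win.ha]
  have hL' : 2 * win.a ≠ 0 := by linarith [win.ha]
  have e1 : evenBlock w win i.succ j.succ =
      weil (2 * win.a) w (thetaEven (2 * win.a) ((i : ℕ) + 1) ((j : ℕ) + 1)) := by
    simp [evenBlock, Fin.val_succ]
  have hfun : (fun y => thetaOdd (2 * win.a) ((i : ℕ) + 1) ((j : ℕ) + 1) y * modeFreq win i
      + thetaEven (2 * win.a) ((i : ℕ) + 1) ((j : ℕ) + 1) y * (-modeFreq win j))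
      = fun y => Real.sin (2 * π * ((((j : ℕ) + 1 : ℕ) : ℝ)) * y / (2 * win.a)) * (2 / (2 * win.a)) := by
    funext y
    have := thetaOdd_displacement hL' (Nat.succ_ne_zero (i : ℕ)) (Nat.succ_ne_zero (j : ℕ)) y
    simp only [modeFreq]
    linear_combination this
  have key := weil_lincomb hL w (Θ₁ := thetaOdd (2 * win.a) ((i : ℕ) + 1) ((j : ℕ) + 1))
    (Θ₂ := thetaEven (2 * win.a) ((i : ℕ) + 1) ((j : ℕ) + 1)) (contDiff_thetaOdd _ _ _)
    (contDiff_thetaEven _ _ _) (modeFreq win i) (-modeFreq win j)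
  rw [hfun, weil_mul_const] at key
  rw [e1]
  simp only [oddBlock, sineWeil]
  linear_combination -key

/-- **PROVED (BORDER RELATION, integrated).** `b_j ω_j = −(√2/L) φ_j`. [folklore] -/
theorem evenBlock_border (w : Weights) (win : Window) (j : Fin win.N) :
    evenBlock w win 0 j.succ * modeFreq win j = -(Real.sqrt 2 / (2 * win.a) * sineWeil w win j) := by
  have hL' : 2 * win.a ≠ 0 := by linarith [win.ha]
  have e2 : evenBlock w win 0 j.succ = weil (2 * win.a) w (thetaEven (2 * win.a) 0 ((j : ℕ) + 1)) := by
    simp [evenBlock, Fin.val_succ]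
  have hfun : (fun y => thetaEven (2 * win.a) 0 ((j : ℕ) + 1) y * modeFreq win j)
      = fun y => Real.sin (2 * π * ((((j : ℕ) + 1 : ℕ) : ℝ)) * y / (2 * win.a)) *
          (-(Real.sqrt 2 / (2 * win.a))) := by
    funext y
    have := thetaEven_border hL' (Nat.succ_ne_zero (j : ℕ)) y
    simp only [modeFreq]
    linear_combination this
  have key := weil_mul_const (2 * win.a) (modeFreq win j) w (thetaEven (2 * win.a) 0 ((j : ℕ) + 1))
  rw [hfun, weil_mul_const] at key
  rw [e2]
  simp only [sineWeil]
  linear_combination -key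

/-- **THE WEIL PARITY PAIR of a weight table at a window** — the abstract `ParityPair` structure
(cand-3, `PfPersistenceParityTransfer`) INSTANTIATED by the actual finite sections: corner / border / body of the
even block, the odd block, `ω_j = 2π(j+1)/L`, `φ_j = W(sin(ω_j ·))`, `κ = 2/L`, `β = √2/L`, with the displacement
and border relations PROVED for every weight table. [folklore] -/
def weilParityPair (w : Weights) (win : Window) : ParityPair win.N where
  q00 := evenBlock w win 0 0
  b := fun j => evenBlock w win 0 j.succ
  P := fun i j => evenBlock w win i.succ j.succ
  M := oddBlock w win
  ω := modeFreq win
  φ := sineWeil w win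
  κ := 2 / (2 * win.a)
  β := Real.sqrt 2 / (2 * win.a)
  P_symm := Matrix.IsSymm.ext fun i j => (evenBlock_isSymm w win).apply i.succ j.succ
  M_symm := oddBlock_isSymm w win
  displacement := oddBlock_displacement w win
  border := evenBlock_border w win
  ω_ne := fun j => (modeFreq_pos win j).ne'
  β_ne := (div_pos (by positivity) (by linarith [win.ha])).ne'

/-! ## §2 Eigenpairs of the pair are eigenpairs of the blocks -/

/-- PROVED: `(ε; v₀, tail v)` is an even eigenpair of the pair iff `v` is an eigenvector of the even block. [folklore] -/
theorem isEvenEigen_iff (w : Weights) (win : Window) (ε : ℝ) (v : Fin (win.N + 1) → ℝ) :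
    (weilParityPair w win).IsEvenEigen ε (v 0) (Fin.tail v) ↔ evenBlock w win *ᵥ v = ε • v := by
  have hs : ∀ i : Fin win.N, evenBlock w win 0 i.succ = evenBlock w win i.succ 0 :=
    fun i => (evenBlock_isSymm w win).apply i.succ 0
  rw [funext_iff, Fin.forall_fin_succ]
  simp only [ParityPair.IsEvenEigen, weilParityPair, Matrix.mulVec, dotProduct, Fin.tail, Pi.smul_apply,
    smul_eq_mul, Fin.sum_univ_succ, hs]
  constructor
  · rintro ⟨h1, h2⟩
    exact ⟨h1, fun i => by have := h2 i; linarith⟩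
  · rintro ⟨h1, h2⟩
    exact ⟨h1, fun i => by have := h2 i; linarith⟩

/-- PROVED: odd eigenpairs of the pair are eigenpairs of the odd block. [folklore] -/
theorem isOddEigen_iff (w : Weights) (win : Window) (μ : ℝ) (u : Fin win.N → ℝ) :
    (weilParityPair w win).IsOddEigen μ u ↔ oddBlock w win *ᵥ u = μ • u := by
  rw [funext_iff]
  rfl

/-- PROVED: the pair's EDGE SUM of `(v₀, tail v)` is `(2/L)^{1/2} θ_v(a)`, the edge value of the profile. [folklore] -/
theorem edgeSum_eq_profile (w : Weights) (win : Window) (v : Fin (win.N + 1) → ℝ) :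
    (weilParityPair w win).edgeSum (v 0) (Fin.tail v) =
      Real.sqrt 2 / Real.sqrt (2 * win.a) * profile (2 * win.a) v win.a := by
  have hL : 0 < 2 * win.a := by linarith [win.ha]
  have hp := profile_edge hL v
  rw [show 2 * win.a / 2 = win.a by ring] at hp
  have hss : Real.sqrt (2 * win.a) * Real.sqrt (2 * win.a) = 2 * win.a := Real.mul_self_sqrt hL.le
  have h22 : Real.sqrt 2 * Real.sqrt 2 = 2 := Real.mul_self_sqrt (by norm_num)
  simp only [ParityPair.edgeSum, weilParityPair, Fin.tail]
  rw [hp, div_mul_div_comm, hss, div_mul_eq_mul_div, div_mul_eq_mul_div, ← add_div, mul_add (Real.sqrt 2),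
    ← mul_assoc (Real.sqrt 2), h22]

/-! ## §3 The EDGE × MEAN zero law and the order bit, for every weight table and window -/

/-- **PROVED — THE EDGE × MEAN ZERO LAW (every weight table, every window).** Let `v` be an eigenvector of the
even block with eigenvalue `ε`, `tail v ≠ 0`, and `ε` SIMPLE. Then `θ_v(a) · v₀ = 0` — the profile vanishes at
the edge OR has zero mean — IF AND ONLY IF `ε` is an eigenvalue of the odd block. [folklore] -/
theorem profile_mul_mean_eq_zero_iff (w : Weights) (win : Window) {ε : ℝ} {v : Fin (win.N + 1) → ℝ}
    (hv : evenBlock w win *ᵥ v = ε • v) (htail : Fin.tail v ≠ 0)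
    (hsimple : ∀ v' : Fin (win.N + 1) → ℝ, evenBlock w win *ᵥ v' = ε • v' → ∃ c : ℝ, v' = c • v) :
    profile (2 * win.a) v win.a * v 0 = 0 ↔ ∃ u : Fin win.N → ℝ, u ≠ 0 ∧ oddBlock w win *ᵥ u = ε • u := by
  set D := weilParityPair w win with hD
  have hL : 0 < 2 * win.a := by linarith [win.ha]
  have hK : Real.sqrt 2 / Real.sqrt (2 * win.a) ≠ 0 :=
    (div_pos (by positivity) (Real.sqrt_pos.2 hL)).ne'
  have hu : D.IsEvenEigen ε (v 0) (Fin.tail v) := (isEvenEigen_iff w win ε v).2 hv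
  have heven : ∀ (u0' : ℝ) (u' : Fin win.N → ℝ), D.IsEvenEigen ε u0' u' →
      ∃ c : ℝ, u0' = c * v 0 ∧ u' = c • Fin.tail v := by
    intro u0' u' h
    have h' : evenBlock w win *ᵥ Fin.cons u0' u' = ε • Fin.cons u0' u' := by
      rw [← isEvenEigen_iff]
      simpa only [Fin.cons_zero, Fin.tail_cons] using h
    obtain ⟨c, hc⟩ := hsimple _ h'
    refine ⟨c, ?_, ?_⟩
    · have := congrFun hc 0
      simpa only [Fin.cons_zero, Pi.smul_apply, smul_eq_mul] using this
    · funext j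
      have := congrFun hc j.succ
      simp only [Fin.cons_succ, Pi.smul_apply, smul_eq_mul] at this
      simpa only [Pi.smul_apply, smul_eq_mul, Fin.tail] using this
  have key := D.edgeSum_mul_mean_eq_zero_iff hu htail heven
  rw [edgeSum_eq_profile, mul_assoc, mul_eq_zero, or_iff_right hK] at key
  rw [key]
  simp only [hD, isOddEigen_iff]

/-- **PROVED (one way, no simplicity).** `θ_v(a) · v₀ = 0` for an even eigenvector (`tail v ≠ 0`) puts its
eigenvalue into the odd spectrum. [folklore] -/
theorem exists_oddEigen_of_profile_mul_mean_eq_zero (w : Weights) (win : Window) {ε : ℝ}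
    {v : Fin (win.N + 1) → ℝ} (hv : evenBlock w win *ᵥ v = ε • v) (htail : Fin.tail v ≠ 0)
    (h0 : profile (2 * win.a) v win.a * v 0 = 0) :
    ∃ u : Fin win.N → ℝ, u ≠ 0 ∧ oddBlock w win *ᵥ u = ε • u := by
  set D := weilParityPair w win with hD
  have hu : D.IsEvenEigen ε (v 0) (Fin.tail v) := (isEvenEigen_iff w win ε v).2 hv
  have h0' : D.edgeSum (v 0) (Fin.tail v) * v 0 = 0 := by
    rw [edgeSum_eq_profile, mul_assoc, h0, mul_zero]
  obtain ⟨u, hu0, hu'⟩ := D.exists_isOddEigen_of_edgeSum_mul_mean_eq_zero hu htail h0'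
  exact ⟨u, hu0, (isOddEigen_iff w win ε u).1 hu'⟩

/-- **PROVED (THE ORDER BIT AT AN EDGE OR MEAN ZERO).** If an even eigenvector with eigenvalue `ε`
(`tail v ≠ 0`) has `θ_v(a) · v₀ = 0`, then the odd bottom is `≤ ε`: `ε₁(oddBlock) ≤ ε`. [folklore] -/
theorem bottomRayleigh_oddBlock_le (w : Weights) (win : Window) {ε : ℝ} {v : Fin (win.N + 1) → ℝ}
    (hv : evenBlock w win *ᵥ v = ε • v) (htail : Fin.tail v ≠ 0)
    (h0 : profile (2 * win.a) v win.a * v 0 = 0) : bottomRayleigh (oddBlock w win) ≤ ε := by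
  obtain ⟨u, hu0, hu⟩ := exists_oddEigen_of_profile_mul_mean_eq_zero w win hv htail h0
  have huu : u ⬝ᵥ u ≠ 0 := fun h => hu0 (dotProduct_self_eq_zero.1 h)
  have hq : u ⬝ᵥ (oddBlock w win *ᵥ u) / (u ⬝ᵥ u) = ε := by
    rw [hu, dotProduct_smul, smul_eq_mul, mul_div_assoc, div_self huu, mul_one]
  exact hq ▸ bottomRayleigh_le_rayleigh _ hu0

/-- **PROVED (contrapositive: what "EVEN IS STRICTLY BOTTOM" forces).** If at a window the even bottom is
STRICTLY below the odd bottom, then every bottom vector `v` of the even block with `tail v ≠ 0` has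
`θ_v(a) · v₀ ≠ 0`: non-zero edge value AND non-zero mean. [folklore] -/
theorem profile_mul_mean_ne_zero_of_bottom_lt (w : Weights) (win : Window) {v : Fin (win.N + 1) → ℝ}
    (hv : IsBottomVector (evenBlock w win) v) (htail : Fin.tail v ≠ 0)
    (hlt : bottomRayleigh (evenBlock w win) < bottomRayleigh (oddBlock w win)) :
    profile (2 * win.a) v win.a * v 0 ≠ 0 := fun h0 =>
  absurd hlt (not_lt.2 (bottomRayleigh_oddBlock_le w win hv.2 htail h0))

end Summit.RiemannHypothesis.RiemannHypothesis.Theorems.PfPersistence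

end
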